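import Summits.BirchSwinnertonDyer.BirchSwinnertonDyer.Theorems.SoloInformedJointGrossZagier

/-!
# SoloInformedJointUniform — the `p`-uniform joint receptacle and the weakest `p`-adic input

`SoloInformedJointGrossZagier` typed the joint higher Gross–Zagier identity `(ZZ_r)` with the
family of points allowed to depend on the prime `p`, and derived the summit from `(ZZ_r)_{r ≥ 2}`
plus `p`-adic ANISOTROPY at a fixed prime. BSD ∧ `p`-adic BSD predict more: ONE family (a
Mordell–Weil basis) and ONE rational `c = #Ш ∏ c_v /(#E(ℚ)_tors² ϖ)` serve EVERY good ordinary
`p` (Mazur–Tate–Teitelbaum 1986, §II.10; tree `PAdicBSDConjecture`). This file types that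
`p`-uniform receptacle `(ZZ_r^u)` (`JointHigherGrossZagierUnif r`) and shows that with it the
transcendence input drops to the weakest statement of its kind:

* `PAdicHeightSomewhereNondegenerate`: every Néron–Tate-independent finite family of rational
  points has non-zero canonical `p`-adic Gram determinant at SOME good ordinary prime `p ≥ 5`
  (implied by anisotropy at the supplied prime, `soloInformedUnif_somewhere_of_anisotropic`; for
  one point it asks for one prime with `ĥ_p(P) ≠ 0`).
* `soloInformedUnif_degenerate_everywhere_of_lt`: under `(ZZ_r^u)` for `E` (analytic rank `r`),
  modularity and Kato's bound, `rank E(ℚ) > r` forces the uniform Gross–Zagier family — a family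
  with NON-ZERO Néron–Tate Gram determinant — to have ZERO `p`-adic Gram determinant at EVERY good
  ordinary `p ≥ 5` (from `soloInformedJoint_padicRegulatorOf_eq_zero_of_lt`, prime by prime).
* `soloInformedUnif_birchSwinnertonDyer`: hence `BirchSwinnertonDyer` from Gross–Zagier–Kolyvagin
  (`r_an ≤ 1`), modularity, Kato, the supply facts, `(ZZ_r^u)_{r ≥ 2}` and
  `PAdicHeightSomewhereNondegenerate`.
* `soloInformedUnif_padicRegulatorOf_ne_zero_iff`: on a pair `(P, c)` satisfying the `p`-adic
  identity with `c ≠ 0`, `det⟨Pᵢ,Pⱼ⟩_D ≠ 0 ↔ [T^r] L_p ≠ 0` (`1 - α⁻¹ ≠ 0`, `log_p γ = p·unit ≠ 0`):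
  given `(ZZ_r)`, the `p`-adic ORDER door `ord_T L_p(E,T) ≤ r_an(E)` of
  `SoloInformedFirstInstances` is literally Schneider non-degeneracy on the Gross–Zagier lattice,
  and the Selmer door `corank Sel_{p^∞} ≤ r_an` follows from it by Kato.

* `soloInformedUnif_one_of_perrinRiou`: the first rung `(ZZ_1^u)` IS a theorem in print — the
  prime-wise Perrin-Riou fact `perrinRiou_rankOne_leadingTerms` + `rank = 1` (Gross–Zagier–
  Kolyvagin) + modularity: two rational points of a rank-one curve are dependent modulo torsion,
  and both pairings are quadratic and kill torsion, so one point and one `c` serve every prime.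

Nothing here constructs points: `(ZZ_r^u)` for `r ≥ 2` is open with no receptacle in print.
-/

noncomputable section

open scoped Classical MatrixGroups ModularForm

open CongruenceSubgroup Literature.NumberTheory.EllipticCurves
  Literature.NumberTheory.EllipticCurves.ModularForms WeierstrassCurve WeierstrassCurve.Affine.Point
  Matrix

namespace Summit.BirchSwinnertonDyer.BirchSwinnertonDyer.Theorems

/-- **`(ZZ_r^u)`, the `p`-uniform joint higher Gross–Zagier identity (conjectural for `r ≥ 2`).**
For `E/ℚ` (globally minimal `W`) of analytic rank `r` and its newform `f` there are ONE family
`P₁,…,P_r ∈ E(ℚ)` and ONE rational `c` with `L^{(r)}(E,1)/r! = c · Ω⁺_f · det⟨Pᵢ,Pⱼ⟩_NT` and, for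
EVERY prime `p ≥ 5` of good ordinary reduction and THE canonical `p`-adic height datum `D`,
`[T^r]L_p(f,α,T) · (log_p γ)^r = c · (1 - α⁻¹)² · det⟨Pᵢ,Pⱼ⟩_D`. The shape of BSD ∧ `p`-adic BSD
for all `p` at once (`PAdicBSDConjecture`: `Pᵢ` a Mordell–Weil basis, the same `c` for all `p`);
implies the prime-wise `JointHigherGrossZagier r` (reorder the quantifiers). Never asserted.
[cite: MazurTateTeitelbaum1986Invent, §II.10] -/
@[conjecture]
def JointHigherGrossZagierUnif (r : ℕ) : Prop :=
  ∀ (W : WeierstrassCurve ℚ) [W.IsElliptic] [W.IsGloballyMinimal], W.analyticRank = r →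
    ∀ ⦃N : ℕ⦄ [NeZero N] (f : CuspForm (Gamma0 N) 2), IsNewformOf W f →
    ∃ (P : Fin r → W.toAffine.Point) (c : ℚ),
      W.leadingLCoeff = (((c : ℝ) * plusPeriod f * regulatorOf P : ℝ) : ℂ) ∧
      ∀ (p : ℕ) [Fact p.Prime], 5 ≤ p → IsOrdinaryAt W p →
        ∀ (D : WeierstrassCurve.PAdicHeightData W p), D.IsCanonical →
          PowerSeries.coeff r (padicLFunction f (unitRoot W p : ℚ_[p])) *
              padicLog p (cyclotomicGenerator p) ^ r =
            (c : ℚ_[p]) * (1 - (unitRoot W p : ℚ_[p])⁻¹) ^ 2 * padicRegulatorOf D P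

/-- **Somewhere-non-degeneracy of the canonical `p`-adic height on rational families (open).**
Every finite family of rational points of `E/ℚ` (globally minimal `W`) with non-zero Néron–Tate
Gram determinant has non-zero canonical `p`-adic Gram determinant at SOME prime `p ≥ 5` of good
ordinary reduction. The weakest non-degeneracy statement of Schneider type: for a one-point family
it asks for one ordinary prime with `ĥ_p(P) ≠ 0` (known for CM curves by Bertrand's theorem, at
every such prime; open for non-CM curves). Never asserted. [cite: Schneider1982PadicHeightI, §1] -/
@[conjecture]
def PAdicHeightSomewhereNondegenerate : Prop :=
  ∀ (W : WeierstrassCurve ℚ) [W.IsElliptic] [W.IsGloballyMinimal] ⦃r : ℕ⦄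
    (P : Fin r → W.toAffine.Point), regulatorOf P ≠ 0 →
    ∃ (p : ℕ) (_ : Fact p.Prime) (D : WeierstrassCurve.PAdicHeightData W p),
      5 ≤ p ∧ IsOrdinaryAt W p ∧ D.IsCanonical ∧ padicRegulatorOf D P ≠ 0

/-- Anisotropy at every good ordinary prime (`PAdicHeightAnisotropic`) plus the supply of one such
prime `p ≥ 5` (`exists_good_ordinary_prime`, Serre 1981 §8) and of the canonical datum
(`exists_isCanonical`) give somewhere-non-degeneracy. [cite: Serre1981, §8] -/
theorem soloInformedUnif_somewhere_of_anisotropic (hA : PAdicHeightAnisotropic)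
    (hOrd : WeierstrassCurve.exists_good_ordinary_prime) (hCan : exists_isCanonical) :
    PAdicHeightSomewhereNondegenerate := by
  intro W _ _ r P hP
  obtain ⟨p, hpF, hp5, hgood, hnd⟩ := hOrd W
  obtain ⟨D, hD⟩ := hCan W p hp5 hgood hnd
  exact ⟨p, hpF, D, hp5, ⟨hgood, hnd⟩, hD, hA W p D hp5 ⟨hgood, hnd⟩ hD P hP⟩

/-! ### The first rung: `(ZZ_1^u)` from Perrin-Riou prime by prime and rank one -/

section NumberField

variable {K : Type*} [Field K] [NumberField K] {W : WeierstrassCurve K}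

/-- In Mordell–Weil rank `< 2` any two points are dependent modulo torsion: `a P + b Q` is torsion
for some `(a, b) ≠ (0, 0)` (two independent points would give rank `≥ 2`,
`soloInformedJoint_card_le_mordellWeilRank_of_linearIndependent`). [cite: SilvermanAEC2009, Thm. VIII.6.7] -/
theorem soloInformedUnif_dep_of_rank_lt_two [W.IsElliptic] (hrk : W.mordellWeilRank < 2)
    (P Q : W.toAffine.Point) : ∃ a b : ℤ, (a ≠ 0 ∨ b ≠ 0) ∧ IsOfFinAddOrder (a • P + b • Q) := by
  have hli : ¬ LinearIndependent ℤ
      (QuotientAddGroup.mk ∘ ![P, Q] : Fin 2 → mordellWeilModTorsion W) := by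
    intro hli
    have h2 := soloInformedJoint_card_le_mordellWeilRank_of_linearIndependent hli
    simp only [Fintype.card_fin] at h2
    omega
  obtain ⟨z, hz0, i₀, hi₀⟩ := Fintype.not_linearIndependent_iff.mp hli
  refine ⟨z 0, z 1, (Fin.exists_fin_two (p := fun i => z i ≠ 0)).mp ⟨i₀, hi₀⟩, ?_⟩
  have h : QuotientAddGroup.mk' (AddCommGroup.torsion W.toAffine.Point) (∑ i, z i • ![P, Q] i) = 0 := by
    simpa only [map_sum, map_zsmul, QuotientAddGroup.mk'_apply, Function.comp_apply] using hz0
  have hT : IsOfFinAddOrder (∑ i, z i • ![P, Q] i) := (QuotientAddGroup.eq_zero_iff _).mp h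
  simpa [Fin.sum_univ_two] using hT

/-- If `a P + b Q` is torsion then `a ⟨P, S⟩ + b ⟨Q, S⟩ = 0` for the Néron–Tate pairing (bilinear,
kills torsion; Silverman AEC Thm. VIII.9.3). [cite: SilvermanAEC2009, Thm. VIII.9.3(c)] -/
theorem soloInformedUnif_heightPairing_dep [W.IsElliptic] {a b : ℤ} {P Q : W.toAffine.Point}
    (h : IsOfFinAddOrder (a • P + b • Q)) (S : W.toAffine.Point) :
    (a : ℝ) * heightPairing P S + (b : ℝ) * heightPairing Q S = 0 := by
  have h0 : heightPairing S (a • P + b • Q) = 0 :=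
    soloInformedJoint_heightPairing_eq_zero_of_isOfFinAddOrder S _ h
  rwa [heightPairing_add_right, heightPairing_zsmul_right, heightPairing_zsmul_right,
    heightPairing_symm S P, heightPairing_symm S Q] at h0

end NumberField

/-- If `a P + b Q` is torsion then `a ⟨P, S⟩_D + b ⟨Q, S⟩_D = 0` for a `p`-adic height datum `D`
(biadditive, kills torsion; MTT 1986 §II.4). The binder `{inst : DecidableEq ℚ}` lets the lemma
accept the torsion hypothesis in the form produced by the general number-field lemmas (classical
decidability) as well as in the form of the `ℚ`-specific data (`instDecidableEqRat`): the two
group laws on `E(ℚ)` agree because `DecidableEq ℚ` is a subsingleton.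
[cite: MazurTateTeitelbaum1986Invent, §II.4] -/
theorem soloInformedUnif_padicPairing_dep (W : WeierstrassCurve ℚ) (p : ℕ) [Fact p.Prime]
    (D : WeierstrassCurve.PAdicHeightData W p) {inst : DecidableEq ℚ} {a b : ℤ}
    {P Q : W.toAffine.Point} (h : IsOfFinAddOrder (a • P + b • Q)) (S : W.toAffine.Point) :
    (a : ℚ_[p]) * D.pairing P S + (b : ℚ_[p]) * D.pairing Q S = 0 := by
  obtain rfl : inst = instDecidableEqRat := Subsingleton.elim _ _
  have h0 : D.pairing S (a • P + b • Q) = 0 := D.map_torsion_right S _ h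
  rwa [map_add, map_zsmul, map_zsmul, zsmul_eq_mul, zsmul_eq_mul, D.symm S P, D.symm S Q] at h0

/-- **`(ZZ_1^u)` is a theorem in print: Perrin-Riou prime by prime + rank one.** From the vendored
prime-wise Perrin-Riou fact (`perrinRiou_rankOne_leadingTerms`, Invent. Math. 89 (1987) Thm. 1.3,
§1.4 Cor. 1.8), modularity, `rank E(ℚ) = 1` in analytic rank one (Gross–Zagier–Kolyvagin,
`rank_eq_analyticRank_of_analyticRank_le_one`) and the supply of one good ordinary `p₀ ≥ 5` with
its canonical datum: the point `P₀` and rational `c₀` of the fact at `p₀` serve at EVERY good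
ordinary `p`. Proof: the fact's point `P₁` at `p` and `P₀` are dependent modulo torsion
(`a P₀ + b P₁` torsion, `b ≠ 0`), so `b² ĥ(P₁) = a² ĥ(P₀)` and `b² ĥ_p(P₁) = a² ĥ_p(P₀)`; the two
archimedean identities give `c₀ ĥ(P₀) = c₁ ĥ(P₁)`, hence `c₀ b² = c₁ a²` in `ℚ`, hence
`c₁ ĥ_p(P₁) = c₀ ĥ_p(P₀)`. [cite: PerrinRiou1987, Thm. 1.3 and §1.4 Cor. 1.8] -/
theorem soloInformedUnif_one_of_perrinRiou (h : perrinRiou_rankOne_leadingTerms)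
    (hE : hasEntireLFunction_rat) (hGZK : rank_eq_analyticRank_of_analyticRank_le_one)
    (hOrd : WeierstrassCurve.exists_good_ordinary_prime) (hCan : exists_isCanonical) :
    JointHigherGrossZagierUnif 1 := by
  intro W _ _ h1 N _ f hf
  obtain ⟨p₀, hpF₀, hp₀, hgood₀, hnd₀⟩ := hOrd W
  obtain ⟨D₀, hD₀⟩ := hCan W p₀ hp₀ hgood₀ hnd₀
  obtain ⟨P₀, c₀, -, hL₀, -⟩ := h W p₀ hp₀ ⟨hgood₀, hnd₀⟩ h1 D₀ hD₀ f hf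
  have hder := (leadingLCoeff_eq_deriv_of_analyticRank_eq_one h1).1
  have hne : W.leadingLCoeff ≠ 0 := leadingLCoeff_ne_zero_holds (W := W) (hE W)
  rw [hder] at hne
  have hne₀ : (c₀ : ℝ) * plusPeriod f * P₀.canonicalHeight ≠ 0 := by
    intro h0; apply hne; rw [hL₀, h0, Complex.ofReal_zero]
  have hΩ : plusPeriod f ≠ 0 := (mul_ne_zero_iff.mp (mul_ne_zero_iff.mp hne₀).1).2
  have hx : P₀.canonicalHeight ≠ 0 := (mul_ne_zero_iff.mp hne₀).2
  refine ⟨fun _ => P₀, c₀, ?_, ?_⟩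
  · rw [hder, hL₀, soloInformedJoint_regulatorOf_fin_one]
  intro p _ hp hord D hD
  obtain ⟨P₁, c₁, -, hL₁, hLp₁⟩ := h W p hp hord h1 D hD f hf
  have hO : (c₀ : ℝ) * plusPeriod f * P₀.canonicalHeight =
      (c₁ : ℝ) * plusPeriod f * P₁.canonicalHeight :=
    Complex.ofReal_injective (hL₀.symm.trans hL₁)
  have key2 : (c₀ : ℝ) * P₀.canonicalHeight = (c₁ : ℝ) * P₁.canonicalHeight :=
    mul_left_cancel₀ hΩ (by linear_combination hO)
  -- rank one: `P₀` and `P₁` are dependent modulo torsion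
  have hrk : W.mordellWeilRank < 2 := by have := (hGZK W (by omega)).1; omega
  obtain ⟨a, b, hab, hT⟩ := soloInformedUnif_dep_of_rank_lt_two hrk P₀ P₁
  have hN0 := soloInformedUnif_heightPairing_dep hT P₀
  have hN1 := soloInformedUnif_heightPairing_dep hT P₁
  rw [heightPairing_self_holds P₀] at hN0
  rw [heightPairing_symm P₀ P₁, heightPairing_self_holds P₁] at hN1
  have hb : b ≠ 0 := by
    rintro rfl
    have ha : a ≠ 0 := hab.resolve_right (fun h => h rfl)
    simp only [Int.cast_zero, zero_mul, add_zero] at hN0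
    exact (mul_ne_zero (Int.cast_ne_zero.mpr ha) hx) hN0
  have key1 : (b : ℝ) ^ 2 * P₁.canonicalHeight = (a : ℝ) ^ 2 * P₀.canonicalHeight := by
    linear_combination (b : ℝ) * hN1 - (a : ℝ) * hN0
  have key3 : ((c₀ : ℝ) * (b : ℝ) ^ 2 - (c₁ : ℝ) * (a : ℝ) ^ 2) * P₀.canonicalHeight = 0 := by
    linear_combination (b : ℝ) ^ 2 * key2 + (c₁ : ℝ) * key1
  have key3' : (c₀ : ℝ) * (b : ℝ) ^ 2 = (c₁ : ℝ) * (a : ℝ) ^ 2 :=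
    sub_eq_zero.mp ((mul_eq_zero.mp key3).resolve_right hx)
  have hq : c₀ * (b : ℚ) ^ 2 = c₁ * (a : ℚ) ^ 2 := by exact_mod_cast key3'
  -- the `p`-adic side
  have hD0 := soloInformedUnif_padicPairing_dep W p D hT P₀
  have hD1 := soloInformedUnif_padicPairing_dep W p D hT P₁
  rw [D.symm P₀ P₁] at hD1
  have key4 : (b : ℚ_[p]) ^ 2 * D.pairing P₁ P₁ = (a : ℚ_[p]) ^ 2 * D.pairing P₀ P₀ := by
    linear_combination (b : ℚ_[p]) * hD1 - (a : ℚ_[p]) * hD0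
  have hq' : (c₀ : ℚ_[p]) * (b : ℚ_[p]) ^ 2 = (c₁ : ℚ_[p]) * (a : ℚ_[p]) ^ 2 := by
    have := congrArg (fun q : ℚ => (q : ℚ_[p])) hq
    push_cast at this
    exact this
  have hbp : (b : ℚ_[p]) ≠ 0 := Int.cast_ne_zero.mpr hb
  have key5 : ((c₁ : ℚ_[p]) * D.pairing P₁ P₁ - (c₀ : ℚ_[p]) * D.pairing P₀ P₀) *
      (b : ℚ_[p]) ^ 2 = 0 := by
    linear_combination (c₁ : ℚ_[p]) * key4 - D.pairing P₀ P₀ * hq'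
  have key5' : (c₁ : ℚ_[p]) * D.pairing P₁ P₁ = (c₀ : ℚ_[p]) * D.pairing P₀ P₀ :=
    sub_eq_zero.mp ((mul_eq_zero.mp key5).resolve_right (pow_ne_zero _ hbp))
  rw [pow_one, soloInformedJoint_padicRegulatorOf_fin_one, hLp₁]
  linear_combination ((1 : ℚ_[p]) - (unitRoot W p : ℚ_[p])⁻¹) ^ 2 * key5'

section OneCurve

variable (W : WeierstrassCurve ℚ) [W.IsElliptic] [W.IsGloballyMinimal] (p : ℕ) [Fact p.Prime]
  {N : ℕ} [NeZero N] (f : CuspForm (Gamma0 N) 2)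

omit [W.IsElliptic] [NeZero N] in
/-- **The `p`-adic order door is Schneider on the Gross–Zagier lattice.** If `(P, c)` satisfies the
`p`-adic identity of `(ZZ_r)` with `c ≠ 0` (`p ≥ 5` good ordinary), then
`det⟨Pᵢ,Pⱼ⟩_D ≠ 0 ↔ [T^r]L_p(f,α,T) ≠ 0`: `1 - α⁻¹ ≠ 0` (`one_sub_unitRoot_inv_ne_zero`, `|α| = √p`)
and `log_p γ = p · u`, `u ∈ ℤ_p^×` (`exists_unit_padicLog_cyclotomicGenerator`, Iwasawa 1972 §4.4).
[cite: Iwasawa1972PadicL, §4.4] -/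
theorem soloInformedUnif_padicRegulatorOf_ne_zero_iff (hp : 5 ≤ p) (hord : IsOrdinaryAt W p)
    (D : WeierstrassCurve.PAdicHeightData W p) {r : ℕ} {P : Fin r → W.toAffine.Point} {c : ℚ}
    (hc : c ≠ 0)
    (hLp : PowerSeries.coeff r (padicLFunction f (unitRoot W p : ℚ_[p])) *
          padicLog p (cyclotomicGenerator p) ^ r =
        (c : ℚ_[p]) * (1 - (unitRoot W p : ℚ_[p])⁻¹) ^ 2 * padicRegulatorOf D P) :
    padicRegulatorOf D P ≠ 0 ↔
      PowerSeries.coeff r (padicLFunction f (unitRoot W p : ℚ_[p])) ≠ 0 := by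
  have hα : (1 : ℚ_[p]) - ((unitRoot W p : ℤ_[p]) : ℚ_[p])⁻¹ ≠ 0 :=
    one_sub_unitRoot_inv_ne_zero W p hord
  have hp2 : p ≠ 2 := by omega
  obtain ⟨u, hu⟩ := exists_unit_padicLog_cyclotomicGenerator p hp2
  have hlog : padicLog p (cyclotomicGenerator p : ℚ_[p]) ≠ 0 := by
    rw [hu]
    refine mul_ne_zero (Nat.cast_ne_zero.mpr (Fact.out : p.Prime).ne_zero) ?_
    exact PadicInt.coe_ne_zero.mpr u.ne_zero
  have hcp : (c : ℚ_[p]) ≠ 0 := by exact_mod_cast hc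
  constructor
  · intro hReg h0
    have h1 : (c : ℚ_[p]) * (1 - (unitRoot W p : ℚ_[p])⁻¹) ^ 2 * padicRegulatorOf D P = 0 := by
      rw [← hLp, h0, zero_mul]
    exact (mul_ne_zero (mul_ne_zero hcp (pow_ne_zero _ hα)) hReg) h1
  · intro hcoeff hReg
    have h1 : PowerSeries.coeff r (padicLFunction f (unitRoot W p : ℚ_[p])) *
        padicLog p (cyclotomicGenerator p) ^ r = 0 := by
      rw [hLp, hReg, mul_zero]
    exact (mul_ne_zero hcoeff (pow_ne_zero _ hlog)) h1

/-- **Excess rank forces `p`-adic degeneracy of the uniform Gross–Zagier family at EVERY good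
ordinary prime.** Under `(ZZ_r^u)` for `E` (globally minimal `W`, analytic rank `r`, newform `f`),
modularity (`hasEntireLFunction_rat`) and Kato's bound at every prime, the uniform family `P` has
`det⟨Pᵢ,Pⱼ⟩_NT ≠ 0`, and if `rank E(ℚ) > r` then `det⟨Pᵢ,Pⱼ⟩_D = 0` for every `p ≥ 5` good ordinary
and the canonical `D` (`soloInformedJoint_padicRegulatorOf_eq_zero_of_lt`, prime by prime). So a
failure of RANK would exhibit a Néron–Tate-non-degenerate rational family that is `p`-adically
degenerate at all good ordinary primes. [cite: Kato2004, Thm 18.4] -/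
theorem soloInformedUnif_degenerate_everywhere_of_lt {r : ℕ} (hZZ : JointHigherGrossZagierUnif r)
    (hE : hasEntireLFunction_rat) (hr : W.analyticRank = r) (hf : IsNewformOf W f)
    (hKato : ∀ (p : ℕ) [Fact p.Prime], kato_selmerCorank_le_order_padicLFunction W p (f := f)) :
    ∃ (P : Fin r → W.toAffine.Point), regulatorOf P ≠ 0 ∧
      (r < W.mordellWeilRank → ∀ (p : ℕ) [Fact p.Prime], 5 ≤ p → IsOrdinaryAt W p →
        ∀ (D : WeierstrassCurve.PAdicHeightData W p), D.IsCanonical → padicRegulatorOf D P = 0) := by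
  obtain ⟨P, c, hL, hall⟩ := hZZ W hr f hf
  refine ⟨P, (soloInformedJoint_ne_zero_of_leadingLCoeff W f hE hL).2, ?_⟩
  intro hlt p _ hp hord D hD
  exact (soloInformedJoint_padicRegulatorOf_eq_zero_of_lt W p f hE hp hord D hf (hKato p) hL
    (hall p hp hord D hD) hlt).1

/-- **RANK for one curve from `(ZZ_r^u)`, Kato and somewhere-non-degeneracy of its family.**
Same setting: if moreover the uniform family is `p`-adically non-degenerate at ONE good ordinary
`p ≥ 5` (canonical `D`), then `rank E(ℚ) = r_an(E)` (lower bound from the archimedean identity,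
upper bound from the previous theorem). [cite: Kato2004, Thm 18.4] -/
theorem soloInformedUnif_rank_eq {r : ℕ} (hZZ : JointHigherGrossZagierUnif r)
    (hE : hasEntireLFunction_rat) (hr : W.analyticRank = r) (hf : IsNewformOf W f)
    (hKato : ∀ (p : ℕ) [Fact p.Prime], kato_selmerCorank_le_order_padicLFunction W p (f := f))
    (hS : ∀ ⦃r : ℕ⦄ (P : Fin r → W.toAffine.Point), regulatorOf P ≠ 0 →
      ∃ (p : ℕ) (_ : Fact p.Prime) (D : WeierstrassCurve.PAdicHeightData W p),
        5 ≤ p ∧ IsOrdinaryAt W p ∧ D.IsCanonical ∧ padicRegulatorOf D P ≠ 0) :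
    W.mordellWeilRank = r := by
  obtain ⟨P, hReg, hdeg⟩ := soloInformedUnif_degenerate_everywhere_of_lt W f hZZ hE hr hf hKato
  have hLB : r ≤ W.mordellWeilRank := by
    simpa using soloInformedJoint_card_le_mordellWeilRank_of_linearIndependent
      (soloInformedJoint_linearIndependent_of_regulatorOf_ne_zero hReg)
  by_contra hne
  have hlt : r < W.mordellWeilRank := lt_of_le_of_ne hLB (Ne.symm hne)
  obtain ⟨p, hpF, D, hp, hord, hD, hRegp⟩ := hS P hReg
  exact hRegp (hdeg hlt p hp hord D hD)

end OneCurve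

/-- **`BirchSwinnertonDyer` from the uniform joint receptacle and somewhere-non-degeneracy.** The
RANK conjecture follows from Gross–Zagier–Kolyvagin in analytic rank `≤ 1`
(`rank_eq_analyticRank_of_analyticRank_le_one`), modularity (`hasEntireLFunction_rat`,
`exists_isNewformOf`), Kato's theorem at every good ordinary prime, the tree theorem on global
minimal models, and exactly two open inputs: `(ZZ_r^u)` for every `r ≥ 2` and
`PAdicHeightSomewhereNondegenerate`. Compared with `soloInformedJoint_birchSwinnertonDyer` the
`p`-adic input is weakened from anisotropy at a given prime to non-degeneracy at one prime per
rational family, at the price of asking the Gross–Zagier family to be uniform in `p` — which BSD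
predicts and which holds at `r = 1` (Perrin-Riou's comparison for the Heegner trace).
[cite: Darmon2004, Thm. 3.22 (= Thm. 1.14) and §3.9] -/
theorem soloInformedUnif_birchSwinnertonDyer
    (hGZK : rank_eq_analyticRank_of_analyticRank_le_one)
    (hE : hasEntireLFunction_rat) (hMod : exists_isNewformOf)
    (hKato : ∀ (W : WeierstrassCurve ℚ) [W.IsElliptic] [W.IsGloballyMinimal] (p : ℕ) [Fact p.Prime]
      {N : ℕ} [NeZero N] {f : CuspForm (Gamma0 N) 2},
      kato_selmerCorank_le_order_padicLFunction W p (f := f))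
    (hZZ : ∀ r : ℕ, 2 ≤ r → JointHigherGrossZagierUnif r)
    (hS : PAdicHeightSomewhereNondegenerate) :
    BirchSwinnertonDyer := by
  unfold BirchSwinnertonDyer Literature.BSDRankConjecture
  intro W hW
  by_cases h2 : 2 ≤ W.analyticRank
  · haveI := hW
    obtain ⟨C, hC⟩ := hasGlobalMinimalModel_rat_holds W
    haveI := hC
    have hran : (C • W).analyticRank = W.analyticRank := analyticRank_variableChange_holds W C
    have hmw : (C • W).mordellWeilRank = W.mordellWeilRank := mordellWeilRank_variableChange_holds W C
    rw [← hran, ← hmw]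
    rw [← hran] at h2
    set V := C • W with hV
    haveI : NeZero (V.conductorNorm ℤ) := ⟨(V.conductorNorm_pos_holds).ne'⟩
    obtain ⟨f, hf⟩ := hMod V
    exact (soloInformedUnif_rank_eq V f (hZZ _ h2) hE rfl hf (fun p _ => hKato V p)
      (fun r P hP => hS V P hP)).symm
  · have h1 : W.analyticRank ≤ 1 := by omega
    haveI := hW
    exact (hGZK W h1).1.symm

end Summit.BirchSwinnertonDyer.BirchSwinnertonDyer.Theorems

end
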